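import Mathlib
import Summits.ResolutionOfSingularities.ResolutionOfSingularities.Theorems.HomologicalConductorPersistenceSurfaceFirstStep
import Summits.ResolutionOfSingularities.ResolutionOfSingularities.Theorems.HomologicalConductorPersistenceSurfaceDoorNonGorenstein
import HarnessLib

/-!
# Rung S-2 `PersistenceSurface` (stmt-ResolutionOfSingularities-19970) — THE FIRST-STEP DOOR OF RECORD:
# the rung from statements about ONE step `loc A → T₁` with `loc A` two-dimensional singular
# (non-Gorenstein for `Sat₄`) and `T₁` singular

Route `ResolutionOfSingularities/HomologicalConductor`, chain W4.4b, rung S-2 `PersistenceSurface`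
(stmt-ResolutionOfSingularities-19970), registered skeleton 1a77c002.  [OURS · bookkeeping over LANDED
tree lemmas; AI-written, weaker than expert review; NOT a statement of the manuscript under study
(Hironaka 2017) and no statement of that manuscript is used.]  DEF-FREE; every conjecture enters only
as a hypothesis.

This file composes the FIRST-STEP REDUCTION (`…PersistenceSurfaceFirstStep`: every stage is stage `0`
of a re-based finitely generated model, `exists_fg_model_tower_eq`) with the exemptions landed by hand
leafhand-res-homologicalconduct-2 (`…SaturationResidualFourGorenstein`: Gorenstein stages satisfy `Sat₄`;
`…LevelFreeRestSingular`: a regular successor closes any transfer step; `…SaturationResidualFour`: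
a singular successor forces Krull dimension `2`).  Result — the sharpest door of the chain so far, every
premise a statement about the single step `T₀ = loc A → T₁` of an admissible surface datum `(A, O)`:

* `saturationFourSurfaceResidual₄_of_firstStep_nonGorenstein` — registered stub (C1) ⇐ `Sat₄(loc A)`
  for `loc A` NOT Gorenstein (`¬ ∀ W f.g., Extⁱ(W, loc A) = 0 ∀ i ≥ 3`), not regular, not a
  monic-hypersurface localisation, not an edim-candidate, of Krull dimension `2`, with `T₁` singular;
* `levelFourPersistenceSurface'_of_firstSteps_singular` — the level-four-source transfer (hence stub
  (C3′), `levelFourPersistenceNonnormalOrNonrational'_of_firstSteps_singular`) ⇐ the three first-step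
  transfers on (R♮) / (Σ6) / (Σ8), each demanded only when `T₁` is SINGULAR and `dim loc A = 2`;
* `persistenceSurface_of_firstSteps_singular` — DOOR OF RECORD: `PersistenceSurface` (by name) ⇐
  first-step non-Gorenstein `Sat₄` + CSP‴ + first-step transfers on (Σ6), (Σ8) at singular `T₁`;
* `persistenceSurface_of_levelFree_firstSteps_singular` — LEVEL-FREE DOOR OF RECORD: the rung ⇐
  `ca(loc A) ⊆ ca(T₁)` on the three classes (normal rational SINGULAR) / (Σ6) / (Σ8) of a
  two-dimensional `loc A` with `T₁` singular.  No saturation, no completion, no level.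

References: res-L1-w44b-plan-1 CHAIN w44b (OURS); W. Bruns, J. Herzog, *Cohen–Macaulay rings*,
Thm. 3.3.10 [`BrunsHerzog1998`]; H. Matsumura, *Commutative Ring Theory*, Thm. 11.7 [`Matsumura1987`].
-/

noncomputable section

-- single-problem summit: the doubled namespace component `ResolutionOfSingularities` is forced
set_option linter.dupNamespace false

namespace Summit.ResolutionOfSingularities.ResolutionOfSingularities.Theorems.HomologicalConductor.PersistenceSurfaceFirstStepDoor

open Summit.ResolutionOfSingularities.ResolutionOfSingularities.Theses.HomologicalConductor
open Summit.ResolutionOfSingularities.ResolutionOfSingularities.Theorems.NoZeno.Birth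
open Summit.ResolutionOfSingularities.ResolutionOfSingularities.Theorems.HomologicalConductor.PersistenceSurfaceSaturationResidual
  (IsMonicHypersurfaceLocalization)
open Summit.ResolutionOfSingularities.ResolutionOfSingularities.Theorems.HomologicalConductor.PersistenceSurfaceSaturationResidualThree
  (IsEdimHypersurfaceCandidate)
open Summit.ResolutionOfSingularities.ResolutionOfSingularities.Theorems.HomologicalConductor.PersistenceSurfaceSaturationResidualFour
open Summit.ResolutionOfSingularities.ResolutionOfSingularities.Theorems.HomologicalConductor.PersistenceSurfaceSaturationGorenstein
  (ca_subset_caAt_four_of_ext_eq_zero)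
open Summit.ResolutionOfSingularities.ResolutionOfSingularities.Theorems.HomologicalConductor.PersistenceSurfaceCompletedStepLevelFree
open Summit.ResolutionOfSingularities.ResolutionOfSingularities.Theorems.HomologicalConductor.PersistenceSurfaceLevelFreeRestSingular
  (caAt_subset_ca_succ_of_isRegularLocalRing_succ)
open Summit.ResolutionOfSingularities.ResolutionOfSingularities.Theorems.HomologicalConductor.PersistenceSurfaceFirstStep

variable {k K : Type} [Field k] [Field K] [Algebra k K]

/-! ## (C1) from first-step `Sat₄` at a non-Gorenstein `loc A` -/

/-- **Registered stub (C1) `SaturationFourSurfaceResidual₄` from FIRST-STEP `Sat₄` at NON-GORENSTEIN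
`loc A`.**  If `ca(loc A) ⊆ ca⁴(loc A)` whenever `loc A` is not Gorenstein (some finitely generated `W`
has `Extⁱ(W, loc A) ≠ 0` for some `i ≥ 3`), not regular, not a monic-hypersurface localisation, not an
edim-candidate, of Krull dimension `2`, and `T₁` is singular, then (C1) holds: by
`saturationFourSurfaceResidual₄_iff_firstStep` only the step `m = 0` matters, and a Gorenstein `loc A`
has `Sat₄` by `ca_subset_caAt_four_of_ext_eq_zero` (o9b′, hand-2). [cite: BrunsHerzog1998, Thm. 3.3.10] -/
theorem saturationFourSurfaceResidual₄_of_firstStep_nonGorenstein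
    (hNG : ∀ p : ℕ, p.Prime → ∀ (k K : Type) [Field k] [CharP k p] [Field K] [Algebra k K]
      (O : ValuationSubring K) (A : Subalgebra k K), (∀ c : k, algebraMap k K c ∈ O) → A.FG →
      IsFractionRing ↥A K → A.toSubring ≤ O.toSubring → ringKrullDim ↥A ≤ 2 →
      ¬ (∀ (W : ModuleCat.{0} ↥(tower O A 0)), Module.Finite ↥(tower O A 0) W → ∀ i : ℕ, 3 ≤ i →
          ∀ e : CategoryTheory.Abelian.Ext.{0} W (ModuleCat.of ↥(tower O A 0) ↥(tower O A 0)) i,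
            e = 0) →
      ¬ IsRegularLocalRing ↥(tower O A 0) → ¬ IsMonicHypersurfaceLocalization k 2 ↥(tower O A 0) →
      ¬ IsEdimHypersurfaceCandidate 2 ↥(tower O A 0) → ¬ IsRegularLocalRing ↥(tower O A 1) →
      ringKrullDim ↥(tower O A 0) = (2 : ℕ) →
      ca (tower O A 0) ⊆
        {x : K | ∃ hx : x ∈ tower O A 0, ∀ i : ℕ, 4 ≤ i → ∀ (M N : ModuleCat.{0} ↥(tower O A 0)),
          Module.Finite ↥(tower O A 0) M → Module.Finite ↥(tower O A 0) N →
            ∀ e : CategoryTheory.Abelian.Ext.{0} M N i, (⟨x, hx⟩ : ↥(tower O A 0)) • e = 0}) :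
    SaturationFourSurfaceResidual₄ := by
  rw [saturationFourSurfaceResidual₄_iff_firstStep]
  intro p hp k K _ _ _ _ O A hk hA hfr hAO hdim hreg hmon hcand hsucc hdim2
  haveI : IsNoetherianRing ↥(tower O A 0) := stub_towerNoetherian k K O A hk hA hfr hAO 0
  by_cases hGor : ∀ (W : ModuleCat.{0} ↥(tower O A 0)), Module.Finite ↥(tower O A 0) W →
      ∀ i : ℕ, 3 ≤ i →
        ∀ e : CategoryTheory.Abelian.Ext.{0} W (ModuleCat.of ↥(tower O A 0) ↥(tower O A 0)) i, e = 0
  · exact ca_subset_caAt_four_of_ext_eq_zero (tower O A 0) hGor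
  · exact hNG p hp k K O A hk hA hfr hAO hdim hGor hreg hmon hcand hsucc hdim2

/-! ## The transfers from first steps at a SINGULAR successor -/

/-- **The level-four-source transfer from FIRST STEPS INTO A SINGULAR STAGE.**  `LevelFourPersistenceSurface'`
follows from the three first-step transfers `ca⁴(loc A) ⊆ ca(T₁)` on (R♮) / (Σ6) / (Σ8), each demanded
only when `T₁` is NOT regular and `ringKrullDim (loc A) = 2`: a regular `T₁` closes the step
(`caAt_subset_ca_succ_of_isRegularLocalRing_succ`), a singular `T₁` forces `dim loc A = 2`
(`ringKrullDim_eq_two_of_not_isRegularLocalRing_succ`), and only the step `m = 0` matters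
(`levelFourPersistenceSurface'_iff_firstStep`). [cite: Matsumura1987, Thm. 11.7] -/
theorem levelFourPersistenceSurface'_of_firstSteps_singular
    (hRN : ∀ p : ℕ, p.Prime → ∀ (k K : Type) [Field k] [CharP k p] [Field K] [Algebra k K]
      (O : ValuationSubring K) (A : Subalgebra k K), (∀ c : k, algebraMap k K c ∈ O) → A.FG →
      IsFractionRing ↥A K → A.toSubring ≤ O.toSubring → ringKrullDim ↥A ≤ 2 →
      ((IsIntegrallyClosed ↥(tower O A 0) ∧
          Literature.AlgebraicGeometry.Resolution.HasRationalSingularity ↥(tower O A 0)) ∨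
        IsRegularLocalRing ↥(tower O A 0)) →
      ¬ IsRegularLocalRing ↥(tower O A 1) → ringKrullDim ↥(tower O A 0) = (2 : ℕ) →
      {x : K | ∃ hx : x ∈ tower O A 0, ∀ i : ℕ, 4 ≤ i → ∀ (M N : ModuleCat.{0} ↥(tower O A 0)),
          Module.Finite ↥(tower O A 0) M → Module.Finite ↥(tower O A 0) N →
            ∀ e : CategoryTheory.Abelian.Ext.{0} M N i, (⟨x, hx⟩ : ↥(tower O A 0)) • e = 0} ⊆
        ca (tower O A 1))
    (hS6 : ∀ p : ℕ, p.Prime → ∀ (k K : Type) [Field k] [CharP k p] [Field K] [Algebra k K]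
      (O : ValuationSubring K) (A : Subalgebra k K), (∀ c : k, algebraMap k K c ∈ O) → A.FG →
      IsFractionRing ↥A K → A.toSubring ≤ O.toSubring → ringKrullDim ↥A ≤ 2 →
      IsIntegrallyClosed ↥(tower O A 0) →
      ¬ Literature.AlgebraicGeometry.Resolution.HasRationalSingularity ↥(tower O A 0) →
      ¬ IsRegularLocalRing ↥(tower O A 0) →
      ¬ IsRegularLocalRing ↥(tower O A 1) → ringKrullDim ↥(tower O A 0) = (2 : ℕ) →
      {x : K | ∃ hx : x ∈ tower O A 0, ∀ i : ℕ, 4 ≤ i → ∀ (M N : ModuleCat.{0} ↥(tower O A 0)),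
          Module.Finite ↥(tower O A 0) M → Module.Finite ↥(tower O A 0) N →
            ∀ e : CategoryTheory.Abelian.Ext.{0} M N i, (⟨x, hx⟩ : ↥(tower O A 0)) • e = 0} ⊆
        ca (tower O A 1))
    (hS8 : ∀ p : ℕ, p.Prime → ∀ (k K : Type) [Field k] [CharP k p] [Field K] [Algebra k K]
      (O : ValuationSubring K) (A : Subalgebra k K), (∀ c : k, algebraMap k K c ∈ O) → A.FG →
      IsFractionRing ↥A K → A.toSubring ≤ O.toSubring → ringKrullDim ↥A ≤ 2 →
      ¬ IsIntegrallyClosed ↥(tower O A 0) →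
      ¬ IsRegularLocalRing ↥(tower O A 1) → ringKrullDim ↥(tower O A 0) = (2 : ℕ) →
      {x : K | ∃ hx : x ∈ tower O A 0, ∀ i : ℕ, 4 ≤ i → ∀ (M N : ModuleCat.{0} ↥(tower O A 0)),
          Module.Finite ↥(tower O A 0) M → Module.Finite ↥(tower O A 0) N →
            ∀ e : CategoryTheory.Abelian.Ext.{0} M N i, (⟨x, hx⟩ : ↥(tower O A 0)) • e = 0} ⊆
        ca (tower O A 1)) :
    LevelFourPersistenceSurface' := by
  rw [levelFourPersistenceSurface'_iff_firstStep]
  intro p hp k K _ _ _ _ O A hk hA hfr hAO hdim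
  by_cases hsucc : IsRegularLocalRing ↥(tower O A 1)
  · exact caAt_subset_ca_succ_of_isRegularLocalRing_succ O A 0 4 hsucc
  · have hdim2 : ringKrullDim ↥(tower O A 0) = (2 : ℕ) :=
      ringKrullDim_eq_two_of_not_isRegularLocalRing_succ hp O A hk hA hfr hAO hdim 0 hsucc
    by_cases hR : (IsIntegrallyClosed ↥(tower O A 0) ∧
        Literature.AlgebraicGeometry.Resolution.HasRationalSingularity ↥(tower O A 0)) ∨
        IsRegularLocalRing ↥(tower O A 0)
    · exact hRN p hp k K O A hk hA hfr hAO hdim hR hsucc hdim2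
    · by_cases hN : IsIntegrallyClosed ↥(tower O A 0)
      · exact hS6 p hp k K O A hk hA hfr hAO hdim hN (fun h => hR (Or.inl ⟨hN, h⟩))
          (fun h => hR (Or.inr h)) hsucc hdim2
      · exact hS8 p hp k K O A hk hA hfr hAO hdim hN hsucc hdim2

/-- **Registered stub (C3′) from FIRST STEPS INTO A SINGULAR STAGE.**
`LevelFourPersistenceNonnormalOrNonrational'` ⇐ `LevelFourPersistenceRationalNormal'` (a consequence of
CSP‴) + the first-step transfers on (Σ6) and (Σ8) at a singular `T₁` with `dim loc A = 2`. [folklore] -/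
theorem levelFourPersistenceNonnormalOrNonrational'_of_firstSteps_singular
    (hR : LevelFourPersistenceRationalNormal')
    (hS6 : ∀ p : ℕ, p.Prime → ∀ (k K : Type) [Field k] [CharP k p] [Field K] [Algebra k K]
      (O : ValuationSubring K) (A : Subalgebra k K), (∀ c : k, algebraMap k K c ∈ O) → A.FG →
      IsFractionRing ↥A K → A.toSubring ≤ O.toSubring → ringKrullDim ↥A ≤ 2 →
      IsIntegrallyClosed ↥(tower O A 0) →
      ¬ Literature.AlgebraicGeometry.Resolution.HasRationalSingularity ↥(tower O A 0) →
      ¬ IsRegularLocalRing ↥(tower O A 0) →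
      ¬ IsRegularLocalRing ↥(tower O A 1) → ringKrullDim ↥(tower O A 0) = (2 : ℕ) →
      {x : K | ∃ hx : x ∈ tower O A 0, ∀ i : ℕ, 4 ≤ i → ∀ (M N : ModuleCat.{0} ↥(tower O A 0)),
          Module.Finite ↥(tower O A 0) M → Module.Finite ↥(tower O A 0) N →
            ∀ e : CategoryTheory.Abelian.Ext.{0} M N i, (⟨x, hx⟩ : ↥(tower O A 0)) • e = 0} ⊆
        ca (tower O A 1))
    (hS8 : ∀ p : ℕ, p.Prime → ∀ (k K : Type) [Field k] [CharP k p] [Field K] [Algebra k K]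
      (O : ValuationSubring K) (A : Subalgebra k K), (∀ c : k, algebraMap k K c ∈ O) → A.FG →
      IsFractionRing ↥A K → A.toSubring ≤ O.toSubring → ringKrullDim ↥A ≤ 2 →
      ¬ IsIntegrallyClosed ↥(tower O A 0) →
      ¬ IsRegularLocalRing ↥(tower O A 1) → ringKrullDim ↥(tower O A 0) = (2 : ℕ) →
      {x : K | ∃ hx : x ∈ tower O A 0, ∀ i : ℕ, 4 ≤ i → ∀ (M N : ModuleCat.{0} ↥(tower O A 0)),
          Module.Finite ↥(tower O A 0) M → Module.Finite ↥(tower O A 0) N →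
            ∀ e : CategoryTheory.Abelian.Ext.{0} M N i, (⟨x, hx⟩ : ↥(tower O A 0)) • e = 0} ⊆
        ca (tower O A 1)) :
    LevelFourPersistenceNonnormalOrNonrational' := by
  have hL : LevelFourPersistenceSurface' :=
    levelFourPersistenceSurface'_of_firstSteps_singular
      (fun p hp k K _ _ _ _ O A hk hA hfr hAO hdim hclass _ _ =>
        hR p hp k K O A hk hA hfr hAO hdim hclass 0)
      hS6 hS8
  intro p hp k K _ _ _ _ O A hk hA hfr hAO hdim caAt' ca' loc' chart' nrm' tower' _ m
  exact hL p hp k K O A hk hA hfr hAO hdim m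

/-! ## The doors of record -/

/-- **DOOR OF RECORD (first-step, singular successor, non-Gorenstein saturation) [OURS].**
`PersistenceSurface` (the route decl, by name) follows from four hypotheses, each about the single step
`loc A → T₁` of an admissible surface datum except CSP‴:
(NG₀) `Sat₄(loc A)` for `loc A` non-Gorenstein in the residual class with `T₁` singular;
(C2) CSP‴ `CompletedStepPersistenceRationalNormal'`;
(Σ6₀) `ca⁴(loc A) ⊆ ca(T₁)` for `loc A` normal, not rational, not regular, `dim 2`, `T₁` singular;
(Σ8₀) the same for `loc A` not normal.  Composition of `saturationFourSurfaceResidual₄_of_firstStep_nonGorenstein`,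
`levelFourPersistenceNonnormalOrNonrational'_of_firstSteps_singular` and the landed door
`persistenceSurface_of_residual₄_of_completedStep'_of_rest'`.  Nothing is asserted. [folklore] -/
theorem persistenceSurface_of_firstSteps_singular
    (hNG : ∀ p : ℕ, p.Prime → ∀ (k K : Type) [Field k] [CharP k p] [Field K] [Algebra k K]
      (O : ValuationSubring K) (A : Subalgebra k K), (∀ c : k, algebraMap k K c ∈ O) → A.FG →
      IsFractionRing ↥A K → A.toSubring ≤ O.toSubring → ringKrullDim ↥A ≤ 2 →
      ¬ (∀ (W : ModuleCat.{0} ↥(tower O A 0)), Module.Finite ↥(tower O A 0) W → ∀ i : ℕ, 3 ≤ i →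
          ∀ e : CategoryTheory.Abelian.Ext.{0} W (ModuleCat.of ↥(tower O A 0) ↥(tower O A 0)) i,
            e = 0) →
      ¬ IsRegularLocalRing ↥(tower O A 0) → ¬ IsMonicHypersurfaceLocalization k 2 ↥(tower O A 0) →
      ¬ IsEdimHypersurfaceCandidate 2 ↥(tower O A 0) → ¬ IsRegularLocalRing ↥(tower O A 1) →
      ringKrullDim ↥(tower O A 0) = (2 : ℕ) →
      ca (tower O A 0) ⊆
        {x : K | ∃ hx : x ∈ tower O A 0, ∀ i : ℕ, 4 ≤ i → ∀ (M N : ModuleCat.{0} ↥(tower O A 0)),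
          Module.Finite ↥(tower O A 0) M → Module.Finite ↥(tower O A 0) N →
            ∀ e : CategoryTheory.Abelian.Ext.{0} M N i, (⟨x, hx⟩ : ↥(tower O A 0)) • e = 0})
    (hC : CompletedStepPersistenceRationalNormal')
    (hS6 : ∀ p : ℕ, p.Prime → ∀ (k K : Type) [Field k] [CharP k p] [Field K] [Algebra k K]
      (O : ValuationSubring K) (A : Subalgebra k K), (∀ c : k, algebraMap k K c ∈ O) → A.FG →
      IsFractionRing ↥A K → A.toSubring ≤ O.toSubring → ringKrullDim ↥A ≤ 2 →
      IsIntegrallyClosed ↥(tower O A 0) →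
      ¬ Literature.AlgebraicGeometry.Resolution.HasRationalSingularity ↥(tower O A 0) →
      ¬ IsRegularLocalRing ↥(tower O A 0) →
      ¬ IsRegularLocalRing ↥(tower O A 1) → ringKrullDim ↥(tower O A 0) = (2 : ℕ) →
      {x : K | ∃ hx : x ∈ tower O A 0, ∀ i : ℕ, 4 ≤ i → ∀ (M N : ModuleCat.{0} ↥(tower O A 0)),
          Module.Finite ↥(tower O A 0) M → Module.Finite ↥(tower O A 0) N →
            ∀ e : CategoryTheory.Abelian.Ext.{0} M N i, (⟨x, hx⟩ : ↥(tower O A 0)) • e = 0} ⊆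
        ca (tower O A 1))
    (hS8 : ∀ p : ℕ, p.Prime → ∀ (k K : Type) [Field k] [CharP k p] [Field K] [Algebra k K]
      (O : ValuationSubring K) (A : Subalgebra k K), (∀ c : k, algebraMap k K c ∈ O) → A.FG →
      IsFractionRing ↥A K → A.toSubring ≤ O.toSubring → ringKrullDim ↥A ≤ 2 →
      ¬ IsIntegrallyClosed ↥(tower O A 0) →
      ¬ IsRegularLocalRing ↥(tower O A 1) → ringKrullDim ↥(tower O A 0) = (2 : ℕ) →
      {x : K | ∃ hx : x ∈ tower O A 0, ∀ i : ℕ, 4 ≤ i → ∀ (M N : ModuleCat.{0} ↥(tower O A 0)),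
          Module.Finite ↥(tower O A 0) M → Module.Finite ↥(tower O A 0) N →
            ∀ e : CategoryTheory.Abelian.Ext.{0} M N i, (⟨x, hx⟩ : ↥(tower O A 0)) • e = 0} ⊆
        ca (tower O A 1)) :
    Summit.ResolutionOfSingularities.ResolutionOfSingularities.Theses.HomologicalConductor.PersistenceSurface :=
  persistenceSurface_of_residual₄_of_completedStep'_of_rest'
    (saturationFourSurfaceResidual₄_of_firstStep_nonGorenstein hNG) hC
    (levelFourPersistenceNonnormalOrNonrational'_of_firstSteps_singular
      (levelFourPersistenceRationalNormal'_of_completedStep' hC) hS6 hS8)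

/-- **LEVEL-FREE DOOR OF RECORD (first-step, singular successor) [OURS].**  `PersistenceSurface` (by name)
follows from `ca(loc A) ⊆ ca(T₁)` demanded only for admissible surface data with `loc A` of Krull
dimension `2` and `T₁` SINGULAR, on the three classes (R) `loc A` normal with a rational singularity, not
regular; (Σ6) `loc A` normal, not rational, not regular; (Σ8) `loc A` not normal.  A regular `T₁` closes
the step (`ca_subset_ca_succ_of_isRegularLocalRing_succ`), a regular `loc A` has `T₁ = loc A`
(`firstStep_of_isRegularLocalRing`), and only the step `m = 0` matters (`persistenceSurface_iff_firstStep`).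
No saturation, completion or level hypothesis. [cite: Matsumura1987, Thm. 11.7] -/
theorem persistenceSurface_of_levelFree_firstSteps_singular
    (hR : ∀ p : ℕ, p.Prime → ∀ (k K : Type) [Field k] [CharP k p] [Field K] [Algebra k K]
      (O : ValuationSubring K) (A : Subalgebra k K), (∀ c : k, algebraMap k K c ∈ O) → A.FG →
      IsFractionRing ↥A K → A.toSubring ≤ O.toSubring → ringKrullDim ↥A ≤ 2 →
      IsIntegrallyClosed ↥(tower O A 0) →
      Literature.AlgebraicGeometry.Resolution.HasRationalSingularity ↥(tower O A 0) →
      ¬ IsRegularLocalRing ↥(tower O A 0) →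
      ¬ IsRegularLocalRing ↥(tower O A 1) → ringKrullDim ↥(tower O A 0) = (2 : ℕ) →
      ca (tower O A 0) ⊆ ca (tower O A 1))
    (hS6 : ∀ p : ℕ, p.Prime → ∀ (k K : Type) [Field k] [CharP k p] [Field K] [Algebra k K]
      (O : ValuationSubring K) (A : Subalgebra k K), (∀ c : k, algebraMap k K c ∈ O) → A.FG →
      IsFractionRing ↥A K → A.toSubring ≤ O.toSubring → ringKrullDim ↥A ≤ 2 →
      IsIntegrallyClosed ↥(tower O A 0) →
      ¬ Literature.AlgebraicGeometry.Resolution.HasRationalSingularity ↥(tower O A 0) →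
      ¬ IsRegularLocalRing ↥(tower O A 0) →
      ¬ IsRegularLocalRing ↥(tower O A 1) → ringKrullDim ↥(tower O A 0) = (2 : ℕ) →
      ca (tower O A 0) ⊆ ca (tower O A 1))
    (hS8 : ∀ p : ℕ, p.Prime → ∀ (k K : Type) [Field k] [CharP k p] [Field K] [Algebra k K]
      (O : ValuationSubring K) (A : Subalgebra k K), (∀ c : k, algebraMap k K c ∈ O) → A.FG →
      IsFractionRing ↥A K → A.toSubring ≤ O.toSubring → ringKrullDim ↥A ≤ 2 →
      ¬ IsIntegrallyClosed ↥(tower O A 0) →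
      ¬ IsRegularLocalRing ↥(tower O A 1) → ringKrullDim ↥(tower O A 0) = (2 : ℕ) →
      ca (tower O A 0) ⊆ ca (tower O A 1)) :
    Summit.ResolutionOfSingularities.ResolutionOfSingularities.Theses.HomologicalConductor.PersistenceSurface := by
  rw [persistenceSurface_iff_firstStep]
  intro p hp k K _ _ _ _ O A hk hA hfr hAO hdim
  by_cases hsucc : IsRegularLocalRing ↥(tower O A 1)
  · exact ca_subset_ca_succ_of_isRegularLocalRing_succ O A 0 hsucc
  · have hdim2 : ringKrullDim ↥(tower O A 0) = (2 : ℕ) :=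
      ringKrullDim_eq_two_of_not_isRegularLocalRing_succ hp O A hk hA hfr hAO hdim 0 hsucc
    by_cases hreg : IsRegularLocalRing ↥(tower O A 0)
    · exact firstStep_of_isRegularLocalRing hp O A hk hfr hAO hreg
    · by_cases hN : IsIntegrallyClosed ↥(tower O A 0)
      · by_cases hrat : Literature.AlgebraicGeometry.Resolution.HasRationalSingularity ↥(tower O A 0)
        · exact hR p hp k K O A hk hA hfr hAO hdim hN hrat hreg hsucc hdim2
        · exact hS6 p hp k K O A hk hA hfr hAO hdim hN hrat hreg hsucc hdim2
      · exact hS8 p hp k K O A hk hA hfr hAO hdim hN hsucc hdim2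

end Summit.ResolutionOfSingularities.ResolutionOfSingularities.Theorems.HomologicalConductor.PersistenceSurfaceFirstStepDoor

end
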